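import Summits.QuantumFields.YangMills.Theorems.BalabanLadderNTMarkovMirrorBareConverse
import Summits.QuantumFields.YangMills.Theorems.BalabanLadderNTSkewResponseTilt
import HarnessLib

/-!
# Crux `NT` / seam `UVSeamRec.stub_floorsEngine` (S-B), residual MF: the CONJUGATE-RESPONSE currency
# (card `rp-linearised-loop-response` rev 3.5, kernel-checked in the tree)

Helper file (`--supports stmt-QuantumFields-20043`; owner RULINGS R78/R87) of the fleet lead `ym-spine-19353-p1`.
WHICH CLAUSE IT SUPPLIES: the bare lattice mirror floor **MF(4ε)** `4ε ≤ Cov_T(Ṽ_v∘Θ₀, Ṽ_v)` — the R87 residual of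
record of conjunct 2 (two-point floor) of the REGISTERED `UVSeamRec.stub_floorsEngine`, consumed verbatim by
`MarkovMirror.lowerBounds_fst_of_bareFloor_chiral` (p517197) and by
`UVSeamRec.MarkovMirrorFloors.stubFloorsEngine_of_bareFloor_rF` (p518416).

WHAT IS PROVED (general compact `G`, any lattice representation `r`, every coupling `β ≥ 0`, every odd torus):

* §1 `sq_le_sq_mul_cov_negReflect_of_response` — **reflection positivity WITH A BOUNDED WITNESS** on the torus
  `(ℤ/(2S+1))⁴`: for bounded measurable `F, H` of the closed non-negative half, `|H| ≤ K`, a RESPONSE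
  `c ≤ Cov(F∘ϑ, H)` (`c ≥ 0`) forces the mirror floor `c² ≤ K²·Cov(F∘ϑ, F)` — the tree's RPCS
  `Reflection.sq_cov_negReflect_le_odd_pos` (FILS 1978) off the diagonal, positivity of the mirror form
  `CurvatureKernel.OddTorusCovCauchySchwarz`, and `Cov(H∘ϑ, H) ≤ K²` (`MarkovMirror.mirrorForm_le_sq`).
* §2 the `torusE`/cylinder forms `sq_le_sq_mul_mirrorCov_of_response` / `…_of_abs_response` (unsigned response:
  apply the signed form to `±W`), for continuous cylinder observables of `ℤ⁴` in a positive-time window read through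
  the periodic lift.
* §3 **`mirrorFloor_of_abs_response`**: MF(4ε) in EXACTLY the `torusE` shape of p517197/p518416 from an unsigned
  response `c_R ≤ |Cov_T(Ṽ∘Θ₀, W)|` with `4εK² ≤ c_R²` against ANY bounded continuous positive-time cylinder
  witness `W` (the card PINS `W` = the clipped `v`-smeared coarse Lagrangian of Bałaban's block field; the pin is
  the card's text and is not needed for the implication).
* §4 the CONJUGACY reading of the response (citation of record = the tree's tilt calculus
  `SkewResponse.hasDerivAt_integral_tilted`): `hasDerivAt_torusE_tilted_zero` — `Cov_T(W, F)` IS the `t`-derivative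
  at `0` of `⟨W⟩` under Wilson's torus measure tilted by `t·F∘lift`, i.e. for `F = Ṽ_v∘Θ₀` under a LOCAL
  MODULATION OF THE COUPLING on the mirror cube; and the TOWER identities `integral_mul_eq_integral_condExp_mul`,
  `cov_eq_cov_condExp`, `hasDerivAt_tilted_condExp_response` — a witness measurable for a sub-σ-algebra `m` (e.g.
  `σ(block field)`) sees the insertion only through `E[·|m]`.

HONEST FRAMING.  A SUPPLY CURRENCY for MF typed as kernel-checked implications; the response floor (CR) for a
pinned witness is engine-grade OPEN mathematics (dimensional transmutation; barrier `PerturbativeInvisibility`).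
Nothing here asserts MF, NT, the seam or a mass gap. [cite: FrohlichIsraelLiebSimon1978, Thm. 2.1;
OsterwalderSeiler1978, §2]
-/

set_option autoImplicit false

noncomputable section

open MeasureTheory Finset Filter Topology

namespace Summit.QuantumFields.YangMills.Cruxes.NT.ConjugateResponse

/-! ## §1 Reflection positivity with a bounded witness (torus coordinates) -/

section RP

open Literature.MathematicalPhysics.QuantumFieldTheory
open Literature.MathematicalPhysics.QuantumFieldTheory.WilsonSiteRP
open Summit.QuantumFields.YangMills.Cruxes.NT.Reflection (sq_cov_negReflect_le_odd_pos integrable_wilson_of_bdd)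
open Summit.QuantumFields.YangMills.Cruxes.NT.MarkovMirror (mirrorForm_le_sq dependsOn_strictHalf_of_posHalf)
open Summit.QuantumFields.YangMills.Theorems.CurvatureKernel (OddTorusCovCauchySchwarz)

variable {G : Type} [Group G] [TopologicalSpace G] [IsTopologicalGroup G] [CompactSpace G]
  [MeasurableSpace G] [BorelSpace G] {N : ℕ} (ρ : G →* Matrix (Fin N) (Fin N) ℂ)

/-- **Positivity of the mirror form** on the odd torus `(ℤ/(2S+1))⁴` (`S ≥ 1`, `β ≥ 0`, continuous `ρ`): for a
bounded measurable real `F` of the closed non-negative half, `0 ≤ ∫ F∘ϑ · F − (∫ F)²`, `ϑ = GaugeConfig.negReflect`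
(the tree's `CurvatureKernel.OddTorusCovCauchySchwarz`, first conjunct, in the link-set description of
`Reflection.sq_cov_negReflect_le_odd_pos`). [cite: OsterwalderSeiler1978, §2] -/
theorem cov_negReflect_self_nonneg {S : ℕ} (hS : 1 ≤ S) (hρ : Continuous ρ) {β : ℝ} (hβ : 0 ≤ β)
    {F : GaugeConfig 4 (2 * S + 1) G → ℝ} (hFm : Measurable F) (hFb : ∃ K : ℝ, ∀ U, |F U| ≤ K)
    (hFdep : DependsOn F {e : Edge 4 (2 * S + 1) | (e.1 0).val ≤ S ∧ ((e.1.shift e.2) 0).val ≤ S}) :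
    0 ≤ (∫ U, F U.negReflect * F U ∂(wilsonMeasure ρ β)) - (∫ U, F U ∂(wilsonMeasure ρ β)) ^ 2 := by
  have h := (OddTorusCovCauchySchwarz G N ρ hρ β hβ S hS F F hFm hFm hFb hFb
    (dependsOn_strictHalf_of_posHalf hS hFdep) (dependsOn_strictHalf_of_posHalf hS hFdep)).1
  rw [← sq] at h
  exact h

/-- **Mirror floor from a bounded witness with a response.**  On the odd torus `(ℤ/(2S+1))⁴` (`S ≥ 1`, `β ≥ 0`,
continuous `ρ`), let `F, H` be bounded measurable real observables of the closed non-negative half (both endpoints of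
every link at times `≤ S`), `|H| ≤ K`, and suppose the RESPONSE `c ≤ Cov(F∘ϑ, H) := ∫ F∘ϑ·H − ∫F ∫H` with `c ≥ 0`.
Then `c² ≤ K² · (∫ F∘ϑ·F − (∫F)²)`.  Proof: RPCS `Cov(F∘ϑ, H)² ≤ B(F,F)·B(H,H)` (tree
`sq_cov_negReflect_le_odd_pos`), `B(H,H) ≤ K²` (`mirrorForm_le_sq`), `B(F,F) ≥ 0`.
[cite: FrohlichIsraelLiebSimon1978, Thm. 2.1] -/
theorem sq_le_sq_mul_cov_negReflect_of_response {S : ℕ} (hS : 1 ≤ S) (hρ : Continuous ρ)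
    {β : ℝ} (hβ : 0 ≤ β) {F H : GaugeConfig 4 (2 * S + 1) G → ℝ} (hFm : Measurable F) (hHm : Measurable H)
    (hFb : ∃ K : ℝ, ∀ U, |F U| ≤ K) {K : ℝ} (hK : ∀ U, |H U| ≤ K)
    (hFdep : DependsOn F {e : Edge 4 (2 * S + 1) | (e.1 0).val ≤ S ∧ ((e.1.shift e.2) 0).val ≤ S})
    (hHdep : DependsOn H {e : Edge 4 (2 * S + 1) | (e.1 0).val ≤ S ∧ ((e.1.shift e.2) 0).val ≤ S})
    {c : ℝ} (hc : 0 ≤ c)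
    (hResp : c ≤ (∫ U, F U.negReflect * H U ∂(wilsonMeasure ρ β)) -
      (∫ U, F U ∂(wilsonMeasure ρ β)) * (∫ U, H U ∂(wilsonMeasure ρ β))) :
    c ^ 2 ≤ K ^ 2 * ((∫ U, F U.negReflect * F U ∂(wilsonMeasure ρ β)) - (∫ U, F U ∂(wilsonMeasure ρ β)) ^ 2) := by
  have hcs := sq_cov_negReflect_le_odd_pos (d := 4) (L := 2 * S + 1) ρ rfl hS hρ hβ hFm hHm hFb ⟨K, hK⟩
    hFdep hHdep
  have hA := cov_negReflect_self_nonneg ρ hS hρ hβ hFm hFb hFdep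
  have hHH := mirrorForm_le_sq (T := 2 * S + 1) ρ hρ β hHm hK
  have h1 := hcs.trans (mul_le_mul_of_nonneg_left hHH hA)
  have h2 : c ^ 2 ≤ ((∫ U, F U.negReflect * H U ∂(wilsonMeasure ρ β)) -
      (∫ U, F U ∂(wilsonMeasure ρ β)) * (∫ U, H U ∂(wilsonMeasure ρ β))) ^ 2 := pow_le_pow_left₀ hc hResp 2
  linarith

end RP

/-! ## §2 Torus forms: cylinder observables of `ℤ⁴` in a positive-time window, read through the periodic lift -/

section TorusRP

open Literature.MathematicalPhysics.QuantumFieldTheory Literature.MathematicalPhysics.QuantumLattice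
open Summit.QuantumFields.YangMills.Cruxes.OSLegsFromFemtoAndGap.DlrCollarTransfer
open Summit.QuantumFields.YangMills.Cruxes.NT.MarkovMirror (dependsOn_posHalf_of_window continuous_cfgReflect)
open Summit.QuantumFields.YangMills.Cruxes.NT.Reflection (integral_comp_negReflect_odd)

variable (G : Type) [Group G] [TopologicalSpace G] [IsTopologicalGroup G] [CompactSpace G]
  [MeasurableSpace G] [BorelSpace G] (r : LatticeRep G)

/-- `torusE` is invariant under the site reflection `Θ₀` of the lift: `E_T[F∘Θ₀] = E_T[F]` (every coupling, every
torus `2L+1`; `torusLift_negReflect` + `Reflection.integral_comp_negReflect_odd`). [folklore] -/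
theorem torusE_comp_cfgReflect (β : ℝ) (L : ℕ) (F : LGConfig 4 G → ℝ) :
    torusE G r β L (fun V => F (cfgReflect V)) = torusE G r β L F := by
  unfold torusE
  have h := integral_comp_negReflect_odd (d := 4) (L := 2 * L + 1) r.ρ (S := L) rfl r.continuous β
    (fun U => F (torusLift (2 * L + 1) U))
  simp only [torusLift_negReflect] at h
  exact h

/-- `torusE` is odd under negation of the observable. [folklore] -/
theorem torusE_neg (β : ℝ) (L : ℕ) (g : LGConfig 4 G → ℝ) :
    torusE G r β L (fun V => -g V) = -torusE G r β L g := by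
  unfold torusE; exact integral_neg _

/-- **Mirror floor from a bounded witness, torus form.**  On the torus `2L+1` (`L ≥ 1`, `β ≥ 0`): `F` (think `Ṽ_v`)
and the WITNESS `W` are bounded continuous cylinder observables of `ℤ⁴` whose links are based at times in
`[0, L−1]`, `|W| ≤ K`; a RESPONSE `c ≤ Cov_T(F∘Θ₀, W) := torusE(F∘Θ₀ · W) − torusE F · torusE W` (`c ≥ 0`) forces
`c² ≤ K² · Cov_T(F∘Θ₀, F)`. [cite: FrohlichIsraelLiebSimon1978, Thm. 2.1] -/
theorem sq_le_sq_mul_mirrorCov_of_response {β : ℝ} (hβ : 0 ≤ β) (L : ℕ) (hL : 1 ≤ L)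
    {F : LGConfig 4 G → ℝ} (hFc : Continuous F) {MF : ℝ} (hMF : ∀ U, |F U| ≤ MF)
    {SF : Finset (Literature.MathematicalPhysics.QuantumLattice.ZdEdge 4)} (hFS : IsCylinder F SF)
    (hSF : ∀ e ∈ SF, 0 ≤ e.1 0 ∧ e.1 0 + 1 ≤ (L : ℤ))
    {W : LGConfig 4 G → ℝ} (hWc : Continuous W) {K : ℝ} (hK : ∀ U, |W U| ≤ K)
    {SW : Finset (Literature.MathematicalPhysics.QuantumLattice.ZdEdge 4)} (hWS : IsCylinder W SW)
    (hSW : ∀ e ∈ SW, 0 ≤ e.1 0 ∧ e.1 0 + 1 ≤ (L : ℤ))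
    {c : ℝ} (hc : 0 ≤ c)
    (hResp : c ≤ torusE G r β L (fun V => F (cfgReflect V) * W V) - torusE G r β L F * torusE G r β L W) :
    c ^ 2 ≤ K ^ 2 * (torusE G r β L (fun V => F (cfgReflect V) * F V) -
      torusE G r β L (fun V => F (cfgReflect V)) * torusE G r β L F) := by
  haveI := r.secondCountableTopology
  have hposF := dependsOn_posHalf_of_window (G := G) L hFS hSF
  have hposW := dependsOn_posHalf_of_window (G := G) L hWS hSW
  have hFm : Measurable fun U : GaugeConfig 4 (2 * L + 1) G => F (torusLift (2 * L + 1) U) :=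
    (hFc.comp (continuous_torusLift _)).measurable
  have hWm : Measurable fun U : GaugeConfig 4 (2 * L + 1) G => W (torusLift (2 * L + 1) U) :=
    (hWc.comp (continuous_torusLift _)).measurable
  have key := sq_le_sq_mul_cov_negReflect_of_response r.ρ hL r.continuous hβ
    (F := fun U => F (torusLift (2 * L + 1) U)) (H := fun U => W (torusLift (2 * L + 1) U))
    hFm hWm ⟨MF, fun U => hMF _⟩ (fun U => hK _) hposF hposW hc
  rw [torusE_comp_cfgReflect, ← sq]
  unfold torusE at hResp ⊢
  simp only [torusLift_negReflect] at key
  exact key hResp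

/-- **Mirror floor from a bounded witness, UNSIGNED response.**  As `sq_le_sq_mul_mirrorCov_of_response`, with the
response hypothesis `c ≤ |Cov_T(F∘Θ₀, W)|` (apply the signed form to `W` or to `−W`).  This is the form the card
uses: in the tree's convention `dens = Σ Re tr ρ(U_p)` the predicted sign of the block-field response is negative.
[cite: FrohlichIsraelLiebSimon1978, Thm. 2.1] -/
theorem sq_le_sq_mul_mirrorCov_of_abs_response {β : ℝ} (hβ : 0 ≤ β) (L : ℕ) (hL : 1 ≤ L)
    {F : LGConfig 4 G → ℝ} (hFc : Continuous F) {MF : ℝ} (hMF : ∀ U, |F U| ≤ MF)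
    {SF : Finset (Literature.MathematicalPhysics.QuantumLattice.ZdEdge 4)} (hFS : IsCylinder F SF)
    (hSF : ∀ e ∈ SF, 0 ≤ e.1 0 ∧ e.1 0 + 1 ≤ (L : ℤ))
    {W : LGConfig 4 G → ℝ} (hWc : Continuous W) {K : ℝ} (hK : ∀ U, |W U| ≤ K)
    {SW : Finset (Literature.MathematicalPhysics.QuantumLattice.ZdEdge 4)} (hWS : IsCylinder W SW)
    (hSW : ∀ e ∈ SW, 0 ≤ e.1 0 ∧ e.1 0 + 1 ≤ (L : ℤ))
    {c : ℝ} (hc : 0 ≤ c)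
    (hResp : c ≤ |torusE G r β L (fun V => F (cfgReflect V) * W V) - torusE G r β L F * torusE G r β L W|) :
    c ^ 2 ≤ K ^ 2 * (torusE G r β L (fun V => F (cfgReflect V) * F V) -
      torusE G r β L (fun V => F (cfgReflect V)) * torusE G r β L F) := by
  rcases le_abs.mp hResp with h | h
  · exact sq_le_sq_mul_mirrorCov_of_response G r hβ L hL hFc hMF hFS hSF hWc hK hWS hSW hc h
  · have hWc' : Continuous fun U => -W U := hWc.neg
    have hK' : ∀ U, |(-W U)| ≤ K := fun U => by rw [abs_neg]; exact hK U
    have hWS' : IsCylinder (fun U => -W U) SW := by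
      intro U V hUV
      show -W U = -W V
      rw [hWS hUV]
    have h' : c ≤ torusE G r β L (fun V => F (cfgReflect V) * -W V) -
        torusE G r β L F * torusE G r β L (fun V => -W V) := by
      have e1 : torusE G r β L (fun V => F (cfgReflect V) * -W V) =
          -torusE G r β L (fun V => F (cfgReflect V) * W V) := by
        rw [← torusE_neg]; congr 1; funext V; ring
      rw [e1, torusE_neg]; linarith
    exact sq_le_sq_mul_mirrorCov_of_response G r hβ L hL hFc hMF hFS hSF hWc' hK' hWS' hSW hc h'

/-! ## §3 MF(4ε) from an unsigned response against ANY bounded positive-time witness -/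

open Summit.QuantumFields.YangMills.Cruxes.NT.MarkovMirror
  (continuous_cubeSmear exists_abs_cubeSmear_le exists_isCylinder_cubeSmear)

/-- **MF from an unsigned response against any bounded positive-time cylinder witness** (per torus; general
`(G, r)`).  On the torus `2L+1` at `β ≥ 0`, let `Ṽ = Σ_{y ∈ cube(c,b)} w(y)·dens_y` be a cube-carried smeared action
density with `1 ≤ c 0` and `|c 0| + b + 3 ≤ L`, and let the WITNESS `W` be continuous, `|W| ≤ K` (`K > 0`), a
cylinder function of links based at times in `[0, L−1]`.  If the unsigned response
`c_R ≤ |Cov_T(Ṽ∘Θ₀, W)|` holds with `c_R ≥ 0` and `4εK² ≤ c_R²`, then the bare mirror floor **MF(4ε)**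
`4ε ≤ torusE(Ṽ∘Θ₀ · Ṽ) − torusE(Ṽ∘Θ₀)·torusE(Ṽ)` — EXACTLY the clause consumed by
`MarkovMirror.lowerBounds_fst_of_bareFloor_chiral` (p517197) and by
`UVSeamRec.MarkovMirrorFloors.stubFloorsEngine_of_bareFloor_rF` (p518416).  RP–Schwarz off the diagonal.
[cite: FrohlichIsraelLiebSimon1978, Thm. 2.1] -/
theorem mirrorFloor_of_abs_response {β : ℝ} (hβ : 0 ≤ β) (L : ℕ)
    (c : Fin 4 → ℤ) (b : ℕ) (hc1 : 1 ≤ c 0) (hcL : |((c 0 : ℤ) : ℝ)| + (b : ℝ) + 3 ≤ (L : ℝ))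
    (w : (Fin 4 → ℤ) → ℝ)
    {W : LGConfig 4 G → ℝ} (hWc : Continuous W) {K : ℝ} (hK : 0 < K) (hWb : ∀ U, |W U| ≤ K)
    {S : Finset (Literature.MathematicalPhysics.QuantumLattice.ZdEdge 4)} (hWS : IsCylinder W S)
    (hSW : ∀ e ∈ S, 0 ≤ e.1 0 ∧ e.1 0 + 1 ≤ (L : ℤ))
    {ε cR : ℝ} (hcR : 0 ≤ cR) (hεK : 4 * ε * K ^ 2 ≤ cR ^ 2)
    (hCR : cR ≤ |torusE G r β L (fun V => (∑ y ∈ cubeSites c b, w y * dens G r y (cfgReflect V)) * W V) -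
        torusE G r β L (fun V => ∑ y ∈ cubeSites c b, w y * dens G r y V) * torusE G r β L W|) :
    4 * ε ≤ torusE G r β L (fun V =>
        (∑ y ∈ cubeSites c b, w y * dens G r y (cfgReflect V)) * ∑ y ∈ cubeSites c b, w y * dens G r y V) -
      torusE G r β L (fun V => ∑ y ∈ cubeSites c b, w y * dens G r y (cfgReflect V)) *
        torusE G r β L (fun V => ∑ y ∈ cubeSites c b, w y * dens G r y V) := by
  have hL1 : 1 ≤ L := by
    have h1 : (1 : ℝ) ≤ (c 0 : ℝ) := by exact_mod_cast hc1
    have : (1 : ℝ) ≤ L := by linarith [le_abs_self (((c 0 : ℤ) : ℝ))]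
    exact_mod_cast this
  -- `Ṽ`: continuous, bounded, cylinder in the cube window (tree lemmas)
  have hVc := continuous_cubeSmear G r c b w
  obtain ⟨MV, hMV⟩ := exists_abs_cubeSmear_le G r c b w
  obtain ⟨SV, hVS, hSV⟩ := exists_isCylinder_cubeSmear G r c b w
  have hSV' : ∀ e ∈ SV, 0 ≤ e.1 0 ∧ e.1 0 + 1 ≤ (L : ℤ) := by
    intro e he
    have h0 := hSV e he 0
    refine ⟨by linarith [h0.1], ?_⟩
    have : ((e.1 0 : ℤ) : ℝ) + 1 ≤ (L : ℝ) := by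
      have h2 : ((e.1 0 : ℤ) : ℝ) ≤ ((c 0 : ℤ) : ℝ) + (b : ℝ) := by exact_mod_cast h0.2
      linarith [le_abs_self (((c 0 : ℤ) : ℝ))]
    exact_mod_cast this
  -- RP–Schwarz with the witness, then `4 ε K² ≤ c_R² ≤ K² · Cov_T(Ṽ∘Θ₀, Ṽ)`
  have key := sq_le_sq_mul_mirrorCov_of_abs_response G r hβ L hL1 hVc hMV hVS hSV' hWc hWb hWS hSW hcR hCR
  have hK2 : 0 < K ^ 2 := by positivity
  exact le_of_mul_le_mul_left (by linarith [key, hεK]) hK2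

/-! ## §4 The conjugacy reading: the response is a coupling-derivative; the witness sees `E[·|m]` only -/

/-- **Conjugate-coupling response, tree vocabulary.**  Along Wilson's measure on the torus `2L+1` TILTED by
`t · F∘lift` (Mathlib `Measure.tilted`; for `F = Ṽ_v∘Θ₀ = Σ v(aβ·θx)·dens_x`, `dens = Σ Re tr ρ(U_p)`, this is the
Wilson weight with the inverse coupling RAISED by `t·v(aβ·θx)` plaquette-wise in the mirror cube), the one-point
function of a bounded continuous `W` has derivative `Cov_T(W, F) = torusE(W·F) − torusE W · torusE F` at `t = 0` —
the tree's `SkewResponse.hasDerivAt_integral_tilted` read at `0`.  So the response hypothesis of §3 is a floor on the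
modulus of the FIRST-ORDER RESPONSE of `⟨W⟩` to a local modulation of the coupling. [folklore] -/
theorem hasDerivAt_torusE_tilted_zero (β : ℝ) (L : ℕ) {F W : LGConfig 4 G → ℝ}
    (hFc : Continuous F) (hWc : Continuous W) {MF MW : ℝ} (hF : ∀ U, |F U| ≤ MF) (hW : ∀ U, |W U| ≤ MW) :
    HasDerivAt
      (fun t => ∫ U, W (torusLift (2 * L + 1) U)
        ∂((wilsonMeasure (d := 4) (L := 2 * L + 1) r.ρ β).tilted fun U => t * F (torusLift (2 * L + 1) U)))
      (torusE G r β L (fun V => W V * F V) - torusE G r β L W * torusE G r β L F) 0 := by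
  haveI := r.secondCountableTopology
  haveI := isProbabilityMeasure_wilsonMeasure (d := 4) (L := 2 * L + 1) r.ρ r.continuous β
  have hFm : Measurable fun U : GaugeConfig 4 (2 * L + 1) G => F (torusLift (2 * L + 1) U) :=
    (hFc.comp (continuous_torusLift _)).measurable
  have hWm : Measurable fun U : GaugeConfig 4 (2 * L + 1) G => W (torusLift (2 * L + 1) U) :=
    (hWc.comp (continuous_torusLift _)).measurable
  have h := SkewResponse.hasDerivAt_integral_tilted (μ := wilsonMeasure (d := 4) (L := 2 * L + 1) r.ρ β)
    hFm hWm (fun U => hF _) (fun U => hW _) 0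
  rw [SkewResponse.tilted_zero_mul] at h
  unfold torusE
  exact h

/-- **The mirror covariance as a coupling-derivative.**  With `F = Ṽ∘Θ₀`:
`Cov_T(Ṽ∘Θ₀, W) = deriv (t ↦ ∫ W∘lift d(μ_T.tilted (t·(Ṽ∘Θ₀)∘lift))) 0` — the quantity floored in
`mirrorFloor_of_abs_response` is the derivative at `0` of the one-point function of the witness under the
mirror-cube coupling modulation. [folklore] -/
theorem mirrorCov_eq_deriv_tilted (β : ℝ) (L : ℕ) {F W : LGConfig 4 G → ℝ}
    (hFc : Continuous F) (hWc : Continuous W) {MF MW : ℝ} (hF : ∀ U, |F U| ≤ MF) (hW : ∀ U, |W U| ≤ MW) :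
    torusE G r β L (fun V => F (cfgReflect V) * W V) - torusE G r β L F * torusE G r β L W =
      deriv (fun t => ∫ U, W (torusLift (2 * L + 1) U)
        ∂((wilsonMeasure (d := 4) (L := 2 * L + 1) r.ρ β).tilted
          fun U => t * F (cfgReflect (torusLift (2 * L + 1) U)))) 0 := by
  have hFc' : Continuous fun V : LGConfig 4 G => F (cfgReflect V) := hFc.comp continuous_cfgReflect
  have h := hasDerivAt_torusE_tilted_zero G r β L (F := fun V => F (cfgReflect V)) hFc' hWc
    (fun U => hF _) hW
  rw [h.deriv, torusE_comp_cfgReflect]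
  congr 1
  · congr 1; funext V; ring
  · ring

end TorusRP

/-! ### Tower identities (abstract probability): a witness measurable for a sub-σ-algebra -/

section Tower

variable {Ω : Type*} {m mΩ : MeasurableSpace Ω} {μ : Measure Ω}

/-- **Tower identity for a bounded `m`-measurable witness.**  `∫ f·W dμ = ∫ E[f|m]·W dμ`.  With `m = σ(block field)`
and `W = W_β` this is the card's «the witness sees `Ṽ∘Θ₀` ONLY through `E_T[Ṽ∘Θ₀ | 𝔅]`». [folklore] -/
theorem integral_mul_eq_integral_condExp_mul [IsFiniteMeasure μ] (hm : m ≤ mΩ)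
    {f W : Ω → ℝ} (hf : Integrable f μ) (hW : StronglyMeasurable[m] W) {K : ℝ} (hWb : ∀ ω, |W ω| ≤ K) :
    ∫ ω, f ω * W ω ∂μ = ∫ ω, (μ[f|m]) ω * W ω ∂μ := by
  have hWae : AEStronglyMeasurable W μ := (hW.mono hm).aestronglyMeasurable
  have hfW : Integrable (f * W) μ := by
    have : Integrable (fun ω => W ω * f ω) μ :=
      hf.bdd_mul hWae (Filter.Eventually.of_forall fun ω => by simpa [Real.norm_eq_abs] using hWb ω)
    simpa [Pi.mul_def, mul_comm] using this
  have h1 : μ[f * W|m] =ᵐ[μ] μ[f|m] * W := condExp_mul_of_stronglyMeasurable_right hW hfW hf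
  calc ∫ ω, f ω * W ω ∂μ = ∫ ω, (f * W) ω ∂μ := by simp [Pi.mul_apply]
    _ = ∫ ω, (μ[f * W|m]) ω ∂μ := (integral_condExp hm).symm
    _ = ∫ ω, (μ[f|m] * W) ω ∂μ := integral_congr_ae h1
    _ = ∫ ω, (μ[f|m]) ω * W ω ∂μ := by simp [Pi.mul_apply]

/-- Covariance form of the tower identity: `Cov_μ(f, W) = Cov_μ(E[f|m], W)` for a bounded `m`-measurable witness
`W`. [folklore] -/
theorem cov_eq_cov_condExp [IsFiniteMeasure μ] (hm : m ≤ mΩ)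
    {f W : Ω → ℝ} (hf : Integrable f μ) (hW : StronglyMeasurable[m] W) {K : ℝ} (hWb : ∀ ω, |W ω| ≤ K) :
    (∫ ω, f ω * W ω ∂μ) - (∫ ω, f ω ∂μ) * (∫ ω, W ω ∂μ) =
      (∫ ω, (μ[f|m]) ω * W ω ∂μ) - (∫ ω, (μ[f|m]) ω ∂μ) * (∫ ω, W ω ∂μ) := by
  rw [integral_mul_eq_integral_condExp_mul hm hf hW hWb, integral_condExp hm]

/-- **Weak conjugacy.**  For a probability measure `μ`, a bounded measurable insertion `Z` (e.g. `Ṽ∘Θ₀∘lift`) and a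
bounded witness `W` measurable for a sub-σ-algebra `m` (e.g. `σ(block field)`), the response of `⟨W⟩` to tilting by
`t·Z` at `t = 0` is the covariance of `W` with the CONDITIONAL EXPECTATION `E[Z | m]`:
`∂ₜ|₀ ∫ W d(μ.tilted (t·Z)) = ∫ E[Z|m]·W dμ − ∫ E[Z|m] dμ · ∫ W dμ`.  (Tree tilt calculus
`SkewResponse.hasDerivAt_integral_tilted` + the tower identity.)  What a block-field response floor ASSERTS beyond
this identity is a formula/floor for that conditional expectation — the engine's debt, not Lean's. [folklore] -/
theorem hasDerivAt_tilted_condExp_response [IsProbabilityMeasure μ] (hm : m ≤ mΩ)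
    {Z W : Ω → ℝ} (hZ : Measurable Z) (hWm : StronglyMeasurable[m] W) {MZ K : ℝ}
    (hZb : ∀ ω, |Z ω| ≤ MZ) (hWb : ∀ ω, |W ω| ≤ K) :
    HasDerivAt (fun t => ∫ ω, W ω ∂(μ.tilted fun ω => t * Z ω))
      ((∫ ω, (μ[Z|m]) ω * W ω ∂μ) - (∫ ω, (μ[Z|m]) ω ∂μ) * (∫ ω, W ω ∂μ)) 0 := by
  have hW : Measurable W := (hWm.mono hm).measurable
  have h := SkewResponse.hasDerivAt_integral_tilted (μ := μ) hZ hW hZb hWb 0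
  rw [SkewResponse.tilted_zero_mul] at h
  have hZi : Integrable Z μ :=
    (integrable_const MZ).mono' hZ.aestronglyMeasurable (ae_of_all _ fun ω => by
      rw [Real.norm_eq_abs]; exact hZb ω)
  have e := cov_eq_cov_condExp (μ := μ) hm hZi hWm hWb
  have e1 : (∫ ω, W ω * Z ω ∂μ) = ∫ ω, Z ω * W ω ∂μ := by
    congr 1; funext ω; ring
  convert h using 1
  rw [e1, ← e]; ring

end Tower

end Summit.QuantumFields.YangMills.Cruxes.NT.ConjugateResponse

end
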